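import Literature.Algebra.Homology.DiscreteRepStandardResolutionNaturality
import Literature.NumberTheory.GaloisRepresentations.RestrictedCohomologyFunctoriality
import HarnessLib

/-!
# `Extⁿ_{C_{G_S}}(ℤ, M^{N_S}) ≃+ Hⁿ(G_S, M^{N_S})` (restricted ramification) and its naturality in `M`

Topic `NumberTheory/GaloisCohomology`; namespace `Literature.NumberTheory.GaloisCohomology.RestrictedExtTriv`.
Definitions WITH BODIES (`extTrivAddEquivRestrictedCohomology`, `quotientInvariantsMap`) and theorems; no named
fact, no `sorry`, no instance, no notation.  Lane «PT-Ш-S-TC» of cell `bsd-eis` (crux `GoodLatticeBDPValue`),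
brick D5c, sub-brick c1: the bridge `nat_S : H¹(G_S, M^D) ≅ Ext¹_{C_{G_S}}(ℤ, M^D)` of the `Ext` road
(`PoitouTateRestrictedShaExtRoad`: `nat`, `hnat`, `hnatG`) — door-c4's GENERIC comparison
`DiscreteRep.extTrivAddEquivContinuousCohomology` (Harari §4.3 Remark 4.24, any compact `Γ` and any
topologically discrete `Γ`-module with open stabilisers) at `Γ = G_S = Γ_K / N_S` and the `G_S`-module
`M^{N_S}` (`ρ.quotientInvariants (ramificationSubgroup K S)`), whose continuous cohomology IS the tree's
`restrictedCohomology ρ S n`; and its naturality for a continuous `Γ_K`-map `F : M → M'` (door-c4's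
`extTrivAddEquivContinuousCohomology_naturality` at the induced map of `N_S`-invariants), in the two shapes the
road consumes (`_naturality`, `_symm_naturality` = the hypothesis `hnatG` of `ShaExtRoad.pairing_natural` with
`G := quotientInvariantsMap F`).  This is the `S`-version of door-c4's `extTrivAddEquivGaloisCohomology(_naturality)`
(`Γ = Γ_K`).  No arithmetic; nothing about Poitou–Tate duality or BSD is proved here.
AI formalisation, weaker than expert review; established only by the kernel check.

## References
* D. Harari, *Galois Cohomology and Class Field Theory* (2020), §4.3 Remark 4.24, §17.2 (p. 290). [Harari2020]
* J. S. Milne, *Arithmetic Duality Theorems*, 2nd ed. (2006), I §4 (proof of Thm. 4.10, p. 58: `Extʳ(ℤ, ·) = Hʳ(G_S, ·)`).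
  [MilneADT2006]
-/

noncomputable section

open CategoryTheory CategoryTheory.Abelian NumberField IsDedekindDomain
open scoped NumberField ContRepresentation

namespace Literature.NumberTheory.GaloisCohomology

namespace RestrictedExtTriv

open Literature.Algebra.Homology Literature.Algebra.Homology.DiscreteRep
open Literature.NumberTheory.GaloisRepresentations
open Literature.NumberTheory.GaloisRepresentations.DiscreteGaloisModule (restrictedCohomology)

variable {K : Type} [Field K] [NumberField K]
  {M : Type} [AddCommGroup M] [TopologicalSpace M] [DiscreteTopology M]
  {M' : Type} [AddCommGroup M'] [TopologicalSpace M'] [DiscreteTopology M']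
  (ρ : DiscreteGaloisModule K M) (ρ' : DiscreteGaloisModule K M') (S : Set (HeightOneSpectrum (𝓞 K)))

/-- **`Extⁿ_{C_{G_S}}(ℤ, M^{N_S}) ≃+ Hⁿ(G_S, M^{N_S}) = restrictedCohomology ρ S n`** — Harari §4.3 Remark 4.24
at `Γ = G_S` (door-c4's comparison for the `G_S`-module `ρ.quotientInvariants N_S`, an object of `C_{G_S}` as
`DiscreteRep.ofContinuousRep`). [cite: Harari2020, §4.3 Remark 4.24 and §17.2] -/
def extTrivAddEquivRestrictedCohomology (n : ℕ) :
    Ext (triv (Γ := GaloisGroupUnramifiedOutside K S) ℤ)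
        (ofContinuousRep (ρ.quotientInvariants (ramificationSubgroup K S))) n ≃+ restrictedCohomology ρ S n :=
  extTrivAddEquivContinuousCohomology (k := ℤ) (ρ.quotientInvariants (ramificationSubgroup K S)).toTopRep
    (isDiscrete_of_continuousRep (ρ.quotientInvariants (ramificationSubgroup K S))) n

/-- The morphism `M^{N_S} ⟶ M'^{N_S}` of `C_{G_S}` induced by a continuous `Γ_K`-map `F : M → M'`
(Mathlib's `ContinuousRep.invariantsHom`, as a morphism of discrete representations). [cite: Harari2020, §17.2] -/
def quotientInvariantsMap (F : ρ.toTopRep ⟶ ρ'.toTopRep) :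
    ofContinuousRep (ρ.quotientInvariants (ramificationSubgroup K S)) ⟶
      ofContinuousRep (ρ'.quotientInvariants (ramificationSubgroup K S)) :=
  ObjectProperty.homMk (X := ofContinuousRep (ρ.quotientInvariants (ramificationSubgroup K S)))
    (Y := ofContinuousRep (ρ'.quotientInvariants (ramificationSubgroup K S)))
    ((forgetTop ℤ (GaloisGroupUnramifiedOutside K S)).map
      (ContinuousRep.invariantsHom (N := ramificationSubgroup K S) F))

/-- **Naturality of `Extⁿ(ℤ, M^{N_S}) ≃+ Hⁿ(G_S, M^{N_S})` in the module**: `Hⁿ(G_S, F) (Φ_M x) = Φ_{M'} (F_* x)`.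
[cite: Harari2020, §4.3 Remark 4.24] -/
theorem extTrivAddEquivRestrictedCohomology_naturality (F : ρ.toTopRep ⟶ ρ'.toTopRep) (n : ℕ)
    (x : Ext (triv (Γ := GaloisGroupUnramifiedOutside K S) ℤ)
      (ofContinuousRep (ρ.quotientInvariants (ramificationSubgroup K S))) n) :
    (ContinuousCohomology.map (ContinuousMonoidHom.id (GaloisGroupUnramifiedOutside K S))
        (ContinuousRep.invariantsHom (N := ramificationSubgroup K S) F) n).hom
        (extTrivAddEquivRestrictedCohomology ρ S n x) =
      extTrivAddEquivRestrictedCohomology ρ' S n (x.comp (Ext.mk₀ (quotientInvariantsMap ρ ρ' S F)) (add_zero n)) := by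
  -- door-c4's generic naturality, for the `G_S`-modules `M^{N_S}`, `M'^{N_S}` and the map `F^{N_S}`
  have h := extTrivAddEquivContinuousCohomology_naturality (k := ℤ)
    (X := (ρ.quotientInvariants (ramificationSubgroup K S)).toTopRep)
    (Y := (ρ'.quotientInvariants (ramificationSubgroup K S)).toTopRep)
    (isDiscrete_of_continuousRep (ρ.quotientInvariants (ramificationSubgroup K S)))
    (isDiscrete_of_continuousRep (ρ'.quotientInvariants (ramificationSubgroup K S)))
    (ContinuousRep.invariantsHom (N := ramificationSubgroup K S) F) n x
  calc (ContinuousCohomology.map (ContinuousMonoidHom.id (GaloisGroupUnramifiedOutside K S))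
          (ContinuousRep.invariantsHom (N := ramificationSubgroup K S) F) n).hom
          (extTrivAddEquivRestrictedCohomology ρ S n x)
      = (ContinuousCohomology.map (ContinuousMonoidHom.id (GaloisGroupUnramifiedOutside K S))
          (ContinuousRep.invariantsHom (N := ramificationSubgroup K S) F) n).hom
          (extTrivAddEquivContinuousCohomology (k := ℤ) (ρ.quotientInvariants (ramificationSubgroup K S)).toTopRep
            (isDiscrete_of_continuousRep (ρ.quotientInvariants (ramificationSubgroup K S))) n x) := rfl
    _ = extTrivAddEquivContinuousCohomology (k := ℤ) (ρ'.quotientInvariants (ramificationSubgroup K S)).toTopRep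
          (isDiscrete_of_continuousRep (ρ'.quotientInvariants (ramificationSubgroup K S))) n
          (x.comp (Ext.mk₀ (stdBaseMap (k := ℤ)
            (isDiscrete_of_continuousRep (ρ.quotientInvariants (ramificationSubgroup K S)))
            (isDiscrete_of_continuousRep (ρ'.quotientInvariants (ramificationSubgroup K S)))
            (ContinuousRep.invariantsHom (N := ramificationSubgroup K S) F))) (add_zero n)) := h
    _ = extTrivAddEquivRestrictedCohomology ρ' S n
          (x.comp (Ext.mk₀ (quotientInvariantsMap ρ ρ' S F)) (add_zero n)) := rfl

/-- **The same for the inverse `nat_S := Φ⁻¹ : Hⁿ(G_S, M^{N_S}) → Extⁿ(ℤ, M^{N_S})`**: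
`nat_{M'} (Hⁿ(G_S, F) c) = (nat_M c) ∘ F` — the shape of the hypothesis `hnatG` of
`ShaExtRoad.pairing_natural` (with `G := quotientInvariantsMap F`). [cite: Harari2020, §4.3 Remark 4.24] -/
theorem extTrivAddEquivRestrictedCohomology_symm_naturality (F : ρ.toTopRep ⟶ ρ'.toTopRep) (n : ℕ)
    (c : restrictedCohomology ρ S n) :
    (extTrivAddEquivRestrictedCohomology ρ' S n).symm
        ((ContinuousCohomology.map (ContinuousMonoidHom.id (GaloisGroupUnramifiedOutside K S))
          (ContinuousRep.invariantsHom (N := ramificationSubgroup K S) F) n).hom c) =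
      ((extTrivAddEquivRestrictedCohomology ρ S n).symm c).comp
        (Ext.mk₀ (quotientInvariantsMap ρ ρ' S F)) (add_zero n) := by
  apply (extTrivAddEquivRestrictedCohomology ρ' S n).injective
  rw [AddEquiv.apply_symm_apply, ← extTrivAddEquivRestrictedCohomology_naturality, AddEquiv.apply_symm_apply]
  rfl

end RestrictedExtTriv

end Literature.NumberTheory.GaloisCohomology

end
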